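import Literature.NumberTheory.EllipticCurves.NewformGaloisRepIntegralityProofs
import Literature.NumberTheory.EllipticCurves.ModularFormsGamma0FreeModule
import Literature.NumberTheory.EllipticCurves.ModularFunctionField
import HarnessLib

/-!
# Division of cusp forms on `Γ₁(N)` by `E₄` and `E₆`; integral `q`-expansions

Lemmas for the weight reduction of Deligne–Serre 1974, Prop. 2.7 (2.7.2)
(`DeligneSerreProp27WeightReductionProofs`): multiplication of cusp forms on `Γ₁(N)` by the
level-one Eisenstein series `E₄`, `E₆` and the converse division.

## Main results (namespace `Literature.NumberTheory.EllipticCurves.ModularForms`)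

* `exists_int_map_eq_qExpansion_E₄`, `exists_int_map_eq_qExpansion_E₆` — `E₄ = 1 + 240 ∑ σ₃(n) qⁿ`
  and `E₆ = 1 - 504 ∑ σ₅(n) qⁿ` lie in `ℤ⟦q⟧` with constant term `1` (Mathlib
  `EisensteinSeries.E_qExpansion_coeff`, `B₄ = -1/30`, `B₆ = 1/42`); `exists_map_eq_of_map_mul_eq`
  — division by such a series preserves integrality (`E₄` is a unit of `ℤ⟦q⟧`).
* `diamondOp_mulModularForm_ofLevelOne` — `⟨d⟩ (f E) = (⟨d⟩ f) E` for a level-one form `E`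
  (`⟨d⟩` is a slash by an element of `Γ₀(N) ≤ SL₂(ℤ)`, Diamond–Shurman §5.2).
* `qExpansion_mulModularForm_ofLevelOne`, `exists_int_eq_cuspCoeff_mulModularForm` — the
  `q`-expansion of `f E` is the product, integral if both factors are.
* `exists_of_E₆_mul_eq_E₄_mul` — **division**: if `g ∈ S_{k+4}(Γ₁(N))`, `h ∈ S_{k+6}(Γ₁(N))` and
  `E₆ g = E₄ h`, then `g = E₄ f`, `h = E₆ f` for a cusp form `f ∈ S_k(Γ₁(N))` — by the tree's
  division lemma `exists_eq_E6_mul_of_E4_mul_eq` (`E₄`, `E₆` have no common zero on `ℍ`,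
  `1728 Δ = E₄³ - E₆²`; Marks–Mason / Gannon: `E₄, E₆` is a regular sequence) and `E₆ → 1` at `i∞`.

All statements are elementary consequences of Mathlib's level-one theory and of
`ModularFormsGamma0FreeModule`; no named facts are introduced.

## References

* F. Diamond, J. Shurman, *A first course in modular forms*, GTM 228 (2005), §1.1–1.2, §5.2.
* P. Deligne, J.-P. Serre, *Formes modulaires de poids 1*, Ann. Sci. ÉNS (4) 7 (1974), Rem. 2.8.
-/

noncomputable section

open scoped MatrixGroups ModularForm Topology
open CongruenceSubgroup UpperHalfPlane ModularForm Filter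

namespace Literature.NumberTheory.EllipticCurves.ModularForms

/-! ### Integral power series -/

section PowerSeries

/-- A complex power series all of whose coefficients are (casts of) integers is the image of an
integer power series. [folklore] -/
theorem exists_map_eq_of_forall_exists_int_eq {Q : PowerSeries ℂ}
    (h : ∀ n, ∃ z : ℤ, (z : ℂ) = PowerSeries.coeff n Q) :
    ∃ Q₀ : PowerSeries ℤ, Q₀.map (Int.castRingHom ℂ) = Q := by
  choose z hz using h
  refine ⟨PowerSeries.mk z, ?_⟩
  ext n
  simp [hz n]

/-- Division by an integer power series with constant term `1` preserves integrality: if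
`P₀ Q = R₀` with `P₀, R₀ ∈ ℤ⟦q⟧`, `P₀(0) = 1`, then `Q ∈ ℤ⟦q⟧` (`P₀` is a unit of `ℤ⟦q⟧`,
Mathlib `PowerSeries.isUnit_iff_constantCoeff`). [folklore] -/
theorem exists_map_eq_of_map_mul_eq {P₀ R₀ : PowerSeries ℤ}
    (h1 : PowerSeries.constantCoeff P₀ = 1) {Q : PowerSeries ℂ}
    (h : P₀.map (Int.castRingHom ℂ) * Q = R₀.map (Int.castRingHom ℂ)) :
    ∃ Q₀ : PowerSeries ℤ, Q₀.map (Int.castRingHom ℂ) = Q := by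
  have hu : IsUnit P₀ := PowerSeries.isUnit_iff_constantCoeff.mpr (h1 ▸ isUnit_one)
  obtain ⟨u, rfl⟩ := hu
  refine ⟨↑u⁻¹ * R₀, ?_⟩
  rw [map_mul, ← h, ← mul_assoc, ← map_mul, Units.inv_mul, map_one, one_mul]

end PowerSeries

/-! ### `E₄` and `E₆` have integral `q`-expansions with constant term `1` -/

section Eisenstein

open EisensteinSeries

/-- `E₄ = 1 + 240 ∑ₙ σ₃(n) qⁿ ∈ ℤ⟦q⟧`, constant term `1` (Mathlib
`EisensteinSeries.E_qExpansion_coeff` with `B₄ = -1/30`; Diamond–Shurman §1.1). [folklore] -/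
theorem exists_int_map_eq_qExpansion_E₄ :
    ∃ P₀ : PowerSeries ℤ, PowerSeries.constantCoeff P₀ = 1 ∧
      P₀.map (Int.castRingHom ℂ) = qExpansion 1 (⇑E₄ : ℍ → ℂ) := by
  refine ⟨PowerSeries.mk fun n ↦
    if n = 0 then 1 else 240 * (ArithmeticFunction.sigma 3 n : ℤ), ?_, ?_⟩
  · simp [PowerSeries.constantCoeff_mk]
  · ext n
    rw [PowerSeries.coeff_map, PowerSeries.coeff_mk, E_qExpansion_coeff (by norm_num) ⟨2, rfl⟩ n]
    split_ifs with hn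
    · simp
    · rw [show bernoulli 4 = -1 / 30 by decide +kernel]
      simp only [eq_intCast]
      push_cast
      ring

/-- `E₆ = 1 - 504 ∑ₙ σ₅(n) qⁿ ∈ ℤ⟦q⟧`, constant term `1` (Mathlib
`EisensteinSeries.E_qExpansion_coeff` with `B₆ = 1/42`; Diamond–Shurman §1.1). [folklore] -/
theorem exists_int_map_eq_qExpansion_E₆ :
    ∃ P₀ : PowerSeries ℤ, PowerSeries.constantCoeff P₀ = 1 ∧
      P₀.map (Int.castRingHom ℂ) = qExpansion 1 (⇑E₆ : ℍ → ℂ) := by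
  refine ⟨PowerSeries.mk fun n ↦
    if n = 0 then 1 else -504 * (ArithmeticFunction.sigma 5 n : ℤ), ?_, ?_⟩
  · simp [PowerSeries.constantCoeff_mk]
  · ext n
    rw [PowerSeries.coeff_map, PowerSeries.coeff_mk, E_qExpansion_coeff (by norm_num) ⟨3, rfl⟩ n]
    split_ifs with hn
    · simp
    · rw [show bernoulli 6 = 1 / 42 by decide +kernel]
      simp only [eq_intCast]
      push_cast
      ring

end Eisenstein

/-! ### Cusp forms on `Γ₁(N)` times level-one forms -/

section Gamma1

variable {N : ℕ} [NeZero N] {k : ℤ}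

/-- The underlying function of a finite linear combination of cusp forms (`map_sum` for Mathlib's
`CuspForm.coeHom`; cf. `coe_cuspForm_finset_sum` of `NewformsMainLemmaProofs`, not imported
here). [folklore] -/
theorem coe_cuspForm_sum_smul {Γ : Subgroup (GL (Fin 2) ℝ)} [Γ.HasDetOne] {k : ℤ}
    {ι : Type*} (s : Finset ι) (a : ι → ℂ) (x : ι → CuspForm Γ k) :
    (⇑(∑ i ∈ s, a i • x i) : ℍ → ℂ) = ∑ i ∈ s, a i • ⇑(x i) := by
  show CuspForm.coeHom (∑ i ∈ s, a i • x i) = _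
  rw [map_sum]
  exact Finset.sum_congr rfl fun i _ ↦ CuspForm.IsGLPos.coe_smul (x i) (a i)

/-- Multiplication by a fixed modular form (Mathlib `CuspForm.mulModularForm`) commutes with
finite linear combinations of cusp forms. [folklore] -/
theorem sum_smul_mulModularForm {Γ : Subgroup (GL (Fin 2) ℝ)} [Γ.HasDetOne] {k w : ℤ}
    {ι : Type*} (s : Finset ι) (a : ι → ℂ) (x : ι → CuspForm Γ k) (E : ModularForm Γ w) :
    (∑ i ∈ s, a i • x i).mulModularForm E = ∑ i ∈ s, a i • (x i).mulModularForm E := by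
  apply DFunLike.coe_injective
  rw [CuspForm.coe_mulModularForm, coe_cuspForm_sum_smul, coe_cuspForm_sum_smul, Finset.sum_mul]
  exact Finset.sum_congr rfl fun i _ ↦ by rw [CuspForm.coe_mulModularForm, smul_mul_assoc]

/-- `(c • f) E = c • (f E)` for Mathlib's `CuspForm.mulModularForm`. [folklore] -/
theorem smul_mulModularForm {Γ : Subgroup (GL (Fin 2) ℝ)} [Γ.HasDetOne] {k w : ℤ}
    (c : ℂ) (f : CuspForm Γ k) (E : ModularForm Γ w) :
    (c • f).mulModularForm E = c • f.mulModularForm E := by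
  apply DFunLike.coe_injective
  rw [CuspForm.coe_mulModularForm, CuspForm.IsGLPos.coe_smul, CuspForm.IsGLPos.coe_smul,
    CuspForm.coe_mulModularForm, smul_mul_assoc]

/-- **Diamond operators commute with multiplication by a level-one form**:
`⟨d⟩ (f E) = (⟨d⟩ f) E` on `S_k(Γ₁(N))` for `E ∈ M_w(SL₂(ℤ))` (e.g. `E₄`, `E₆`, `Δ`): `⟨d⟩` is
`f ↦ f ∣ γ` for some `γ ∈ Γ₀(N) ≤ SL₂(ℤ)` (Diamond–Shurman §5.2, p. 168;
`coe_cuspHeckeOperatorₗ_gamma1`), and `E ∣ γ = E`; for a non-unit `d` both sides are the junk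
value `id`. [folklore] -/
theorem diamondOp_mulModularForm_ofLevelOne {w : ℤ} (E : ModularForm 𝒮ℒ w) (d : ZMod N)
    (f : CuspForm (Gamma1 N) k) :
    diamondOp N (k + w) d (f.mulModularForm (ofLevelOne (Gamma1 N) E)) =
      (diamondOp N k d f).mulModularForm (ofLevelOne (Gamma1 N) E) := by
  unfold diamondOp
  split_ifs with h
  · apply DFunLike.coe_injective
    change ⇑(cuspHeckeOperatorₗ (Gamma1 N) (k + w) (slToGLPos h.choose) _) = _
    rw [coe_cuspHeckeOperatorₗ_gamma1, CuspForm.coe_mulModularForm, CuspForm.coe_mulModularForm]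
    change _ = ⇑(cuspHeckeOperatorₗ (Gamma1 N) k (slToGLPos h.choose) f) * _
    rw [coe_cuspHeckeOperatorₗ_gamma1, coe_ofLevelOne,
      show (Matrix.SpecialLinearGroup.mapGL ℝ ((h.choose : Gamma0 N) : SL(2, ℤ)) :
          GL (Fin 2) ℝ) = (((h.choose : Gamma0 N) : SL(2, ℤ)) : GL (Fin 2) ℝ) from rfl,
      ← ModularForm.SL_slash, ← ModularForm.SL_slash, ModularForm.mul_slash_SL2]
    congr 1
    rw [ModularForm.SL_slash]
    exact E.slash_action_eq' _ ⟨_, rfl⟩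
  · rfl

/-- The `q`-expansion of `f E` (`f ∈ S_k(Γ₁(N))`, `E` of level one) is the product of the
`q`-expansions (Mathlib `ModularForm.qExpansion_mul_coe`). [folklore] -/
theorem qExpansion_mulModularForm_ofLevelOne {w : ℤ} (E : ModularForm 𝒮ℒ w)
    (f : CuspForm (Gamma1 N) k) :
    qExpansion 1 (⇑(f.mulModularForm (ofLevelOne (Gamma1 N) E))) =
      qExpansion 1 ⇑f * qExpansion 1 ⇑E := by
  rw [CuspForm.coe_mulModularForm]
  exact ModularForm.qExpansion_mul_coe one_pos (HeckeTGamma1.one_mem_strictPeriods_Gamma1 N) f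
    (ofLevelOne (Gamma1 N) E)

/-- If `f ∈ S_k(Γ₁(N))` has integral Fourier coefficients and `E ∈ M_w(SL₂(ℤ))` has an integral
`q`-expansion, then `f E` has integral Fourier coefficients. [folklore] -/
theorem exists_int_eq_cuspCoeff_mulModularForm {w : ℤ} {E : ModularForm 𝒮ℒ w}
    {P₀ : PowerSeries ℤ} (hE : P₀.map (Int.castRingHom ℂ) = qExpansion 1 (⇑E : ℍ → ℂ))
    {f : CuspForm (Gamma1 N) k} (hf : ∀ n, ∃ z : ℤ, (z : ℂ) = cuspCoeff f n) (n : ℕ) :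
    ∃ z : ℤ, (z : ℂ) = cuspCoeff (f.mulModularForm (ofLevelOne (Gamma1 N) E)) n := by
  choose z hz using hf
  refine ⟨PowerSeries.coeff n (PowerSeries.mk z * P₀), ?_⟩
  change _ = PowerSeries.coeff n (qExpansion 1 ⇑(f.mulModularForm (ofLevelOne (Gamma1 N) E)))
  rw [qExpansion_mulModularForm_ofLevelOne, ← hE,
    show qExpansion 1 ⇑f = (PowerSeries.mk z).map (Int.castRingHom ℂ) from ?_, ← map_mul,
    PowerSeries.coeff_map, eq_intCast]
  ext m
  rw [PowerSeries.coeff_map, PowerSeries.coeff_mk, eq_intCast, hz m]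
  rfl

/-- **Division by `E₄` and `E₆` on cusp forms.**  If `g ∈ S_{k+4}(Γ₁(N))` and
`h ∈ S_{k+6}(Γ₁(N))` satisfy `E₆ g = E₄ h`, then `g = E₄ f` and `h = E₆ f` for a (necessarily
unique) cusp form `f ∈ S_k(Γ₁(N))`: `f = g/E₄ = h/E₆` is a holomorphic modular form of weight
`k` because `E₄` and `E₆` have no common zero on `ℍ` (`1728 Δ = E₄³ - E₆²`; the tree's division
lemma `exists_eq_E6_mul_of_E4_mul_eq`), and it vanishes at every cusp because `h` does while
`E₆ → 1` at `i∞` after any `SL₂(ℤ)`-translation. [folklore] -/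
theorem exists_of_E₆_mul_eq_E₄_mul (g : CuspForm (Gamma1 N) (k + 4))
    (h : CuspForm (Gamma1 N) (k + 6)) (heq : (⇑E₆ : ℍ → ℂ) * ⇑g = ⇑E₄ * ⇑h) :
    ∃ f : CuspForm (Gamma1 N) k, f.mulModularForm (ofLevelOne (Gamma1 N) E₄) = g ∧
      f.mulModularForm (ofLevelOne (Gamma1 N) E₆) = h := by
  have hh : (⇑h : ℍ → ℂ) ∈ formSpace (Gamma1 N) (k + 6) :=
    coe_mem_formSpace (h : ModularForm (Gamma1 N) (k + 6))
  have hg : (⇑g : ℍ → ℂ) ∈ formSpace (Gamma1 N) (k + 6 - 2) := by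
    rw [show k + 6 - 2 = k + 4 by ring]
    exact coe_mem_formSpace (g : ModularForm (Gamma1 N) (k + 4))
  obtain ⟨F₀, hF₀, hhF⟩ := exists_eq_E6_mul_of_E4_mul_eq (Subgroup.map_le_range _ _) hh hg heq.symm
  rw [show k + 6 - 6 = k by ring] at hF₀
  obtain ⟨F, hF⟩ := hF₀
  have hcont4 : Continuous (⇑E₄ : ℍ → ℂ) := E₄.holo'.continuous
  -- `F` vanishes at the cusps: `(F ∣ γ) E₆ = h ∣ γ → 0` and `E₆ → 1`
  let f : CuspForm (Gamma1 N) k :=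
    { toFun := F
      slash_action_eq' := F.slash_action_eq'
      holo' := F.holo'
      zero_at_cusps' := fun {c} hc ↦ by
        rw [Subgroup.IsArithmetic.isCusp_iff_isCusp_SL2Z] at hc
        rw [OnePoint.isZeroAt_iff_forall_SL2Z hc]
        intro γ _
        have hslash : (⇑F ∣[k] (γ : GL (Fin 2) ℝ)) * ⇑E₆ = ⇑h ∣[k + 6] (γ : GL (Fin 2) ℝ) := by
          have := ModularForm.mul_slash_SL2 k 6 γ ⇑F ⇑E₆
          rw [← hF, mul_comm] at hhF
          rw [← hhF, show (⇑E₆ ∣[(6 : ℤ)] γ) = ⇑E₆ from E₆.slash_action_eq' _ ⟨γ, rfl⟩] at this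
          simpa [ModularForm.SL_slash] using this.symm
        have hzero : IsZeroAtImInfty (⇑h ∣[k + 6] (γ : GL (Fin 2) ℝ)) := by
          simpa [ModularForm.SL_slash] using CuspFormClass.zero_at_infty_slash h γ
        have hev : ∀ᶠ z in atImInfty, (⇑F ∣[k] (γ : GL (Fin 2) ℝ)) z =
            (⇑h ∣[k + 6] (γ : GL (Fin 2) ℝ)) z * (E₆ z)⁻¹ := by
          filter_upwards [tendsto_E6_atImInfty.eventually_ne one_ne_zero] with z hz
          rw [← congrFun hslash z, Pi.mul_apply, mul_inv_cancel_right₀ hz]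
        have hlim : Tendsto (fun z ↦ (⇑h ∣[k + 6] (γ : GL (Fin 2) ℝ)) z * (E₆ z)⁻¹) atImInfty
            (𝓝 0) := by
          have h2 : Tendsto (fun z ↦ (E₆ z)⁻¹) atImInfty (𝓝 1) := by
            simpa using tendsto_E6_atImInfty.inv₀ one_ne_zero
          simpa using hzero.mul h2
        change Tendsto _ atImInfty (𝓝 0)
        exact hlim.congr' (hev.mono fun z hz ↦ hz.symm) }
  have hcoe : (⇑f : ℍ → ℂ) = ⇑F := rfl
  refine ⟨f, ?_, ?_⟩
  · -- `E₆ (F E₄) = E₄ h = E₆ g`, cancel `E₆`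
    apply DFunLike.coe_injective
    rw [CuspForm.coe_mulModularForm, coe_ofLevelOne, hcoe]
    refine E6_mul_left_cancel ((F.holo'.continuous).mul hcont4) g.holo'.continuous ?_
    rw [heq, hhF, ← hF]
    ring
  · apply DFunLike.coe_injective
    rw [CuspForm.coe_mulModularForm, coe_ofLevelOne, hcoe, hhF, ← hF, mul_comm]

end Gamma1

end Literature.NumberTheory.EllipticCurves.ModularForms
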